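import Mathlib
import Summits.NavierStokesRegularity.NavierStokesRegularity.Theorems.FilamentSkeletonRssDefectColumnGateAzimuthalBlockTwoZoneLoop

/-!
# Route `FilamentSkeletonRss` · crux `TransverseReduction1AG` (stmt-NavierStokesRegularity-27853; A1L twin stmt-23297) · line
# `defect_column_gate_1AG/1AL` — sizes of the pieces of the two-zone constants (prelude to `twoZone_constants_le`)

Helper file (`--supports stmt-NavierStokesRegularity-27853 --as helper`; seat ns-filament-s2aloc-p1 g2; note ARCHITECTURE-B2B3-s2aloc-g2.md v6 §8).
The output of `twoZone_sup_le` (p680567) is `(1 + u₀ + 2/γ)⁴·T̄ + 16·Q̄` with `T̄, Q̄` explicit in the abbreviations.  `twoZone_constants_le`: with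
`e^{γu₀/4} = Rc³` (the choice `u₀ = (12/γ)log Rc` of `twoZone_loop_large_three`) and `θ′ = (u₀−1/γ)/(e(A₂b+1)c_Φ)` this quantity is
`≤ K_c·(1+u₀)¹¹·Rc³·M_E²`, `K_c = K_c(γ, m)` an explicit polynomial in `γ, 1/γ, 1/m` (abbreviations `a₂, c_φ, a₁, a₃, b₀, f₀, s_S, t_T, K_c` in the
statement), `M_E = M + γ²Rc(1+u₀)²e^{−γu₀/4}N/(8πm)` the folded data size: POLYNOMIAL LOSS `Rc³·(1 + (12/γ)log Rc)¹¹` for the Biot–Savart-coupled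
azimuthal blocks `m ≥ 2` of the symmetric column, uniformly in the support radius.  (The remaining `N² ≤ sup(1+u)⁴(a²+b²)` absorption has coefficient
`2K_c(1+u₀)¹¹Rc³·(γ²(1+u₀)²/(8πmRc²))² = O((1+u₀)¹⁵/Rc)`; not done here.)
HONEST FRAMING: elementary real inequalities serving an a-priori bound for ONE family of blocks of ONE linear MODEL operator of a hypothetical
blow-up route (MODEL rung, negative side); `WaistColumnGateLoc1A`, `TransverseReduction1AG/1AL` are neither proved nor refuted; nothing here
bears on NS regularity.
-/

set_option linter.dupNamespace false

noncomputable section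

namespace Summit.NavierStokesRegularity.NavierStokesRegularity.Theorems.DefectColumnGate

open Set

/-- Monotonicity of a triple product of nonnegative reals. -/
theorem mul_le_mul_three {a b c A B C : ℝ} (h₁ : a ≤ A) (h₂ : b ≤ B) (h₃ : c ≤ C) (ha : 0 ≤ a) (hb : 0 ≤ b) (hc : 0 ≤ c) :
    a * b * c ≤ A * B * C :=
  mul_le_mul (mul_le_mul h₁ h₂ hb (ha.trans h₁)) h₃ hc (mul_nonneg (ha.trans h₁) (hb.trans h₂))

/-- Monotonicity of a fourfold product of nonnegative reals. -/
theorem mul_le_mul_four {a b c d A B C D : ℝ} (h₁ : a ≤ A) (h₂ : b ≤ B) (h₃ : c ≤ C) (h₄ : d ≤ D)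
    (ha : 0 ≤ a) (hb : 0 ≤ b) (hc : 0 ≤ c) (hd : 0 ≤ d) : a * b * c * d ≤ A * B * C * D :=
  mul_le_mul (mul_le_mul_three h₁ h₂ h₃ ha hb hc) h₄ hd
    (mul_nonneg (mul_nonneg (ha.trans h₁) (hb.trans h₂)) (hc.trans h₃))

set_option maxHeartbeats 2000000 in
/-- **Sizes of the pieces of the two-zone constants** (under the abbreviations of `twoZone_sup_le`, `e^{γu₀/4} = Rc³`, the `θ′` choice,
`0 ≤ M`, `0 ≤ N`): every abbreviation is bounded by an explicit monomial in `P = 1 + u₀`, `Rc`, `M²`, `M_E²`. -/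
theorem twoZone_pieces_le
    {γ m Rc u₀ θ' M N Kb ME c₁ κ A₁b A₂b A₃b cΦ φ₀ φ₁ ξ₀ ξ₁ β₀ β₁ β₂ τ₀ τ₁ τ₂ e₁ α₁ α₂ a₂ cφ a₁ a₃ b₀ f₀ : ℝ}
    (hγ : 0 < γ) (hm : 2 ≤ m) (hRc : 1 ≤ Rc) (hu₀ : 64 / γ ≤ u₀) (hu₀1 : 1 ≤ u₀) (hM : 0 ≤ M) (hN : 0 ≤ N)
    (hE : Real.exp (γ * u₀ / 4) = Rc ^ 3)
    (hKb : Kb = 2 * Real.pi * (u₀ + 2 / γ + 4 / γ))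
    (hME : ME = M + γ ^ 2 * Rc / (8 * Real.pi * m) * ((1 + u₀) ^ 2 * Real.exp (-(γ * u₀ / 4))) * N)
    (hc₁ : c₁ = (1 - 16 / (5 * m ^ 2)) * m) (hκ : κ = γ ^ 2 * Rc / (16 * Real.pi * m))
    (hA₁b : A₁b = (u₀ + 2 / γ) * Real.exp (γ * (u₀ + 2 / γ) / 4) / Rc * (4 * Kb * ((γ + 1) * Kb + 4) / c₁ ^ 2 + 1 / 2))
    (hA₂b : A₂b = 4 * ((γ + 1) * Kb + 4) / c₁) (hA₃b : A₃b = κ * (1 + A₂b))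
    (hcΦ : cΦ = 12 * ((1 + 36 * γ ^ 2) * (u₀ + 3 / γ) + 81 * γ / 32 + 81 / 64))
    (hφ₁ : φ₁ = Real.exp (γ * (u₀ + 3 / γ) / 4) * cΦ)
    (hφ₀ : φ₀ = Real.exp (γ * (u₀ + 3 / γ) / 4) * (cΦ * (16 * ME ^ 2 / (γ ^ 2 * u₀ ^ 4)) + 243 / 8 * (ME ^ 2 / (1 + u₀) ^ 4)))
    (hξ₁ : ξ₁ = u₀ ^ 2 / 2) (hξ₀ : ξ₀ = 8 * ME ^ 2 / (γ ^ 2 * u₀ ^ 2))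
    (hβ₀ : β₀ = Kb * (4 * Kb * (M ^ 2 * ((u₀ + 2 / γ) * Real.exp (γ * (u₀ + 2 / γ) / 4))) / (c₁ ^ 2 * Rc ^ 2)))
    (hβ₁ : β₁ = Kb * (4 / (c₁ * Rc))) (hβ₂ : β₂ = Kb * (4 * κ / (c₁ * Rc)))
    (hτ₀ : τ₀ = A₁b * M ^ 2) (hτ₁ : τ₁ = A₂b + 1) (hτ₂ : τ₂ = A₃b)
    (he₁ : e₁ = Real.exp (1 / 4) / Real.exp (γ * u₀ / 4)) (hα₁ : α₁ = γ + 1 / θ') (hα₂ : α₂ = θ' / (4 * (u₀ - 1 / γ)))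
    (hθ' : θ' = (u₀ - 1 / γ) / (Real.exp 1 * (A₂b + 1) * cΦ))
    (ha₂ : a₂ = 20 / m * (4 * Real.pi * (γ + 1) + 4) + 1)
    (hcφ : cφ = 12 * (2 * (1 + 36 * γ ^ 2) + 81 * γ / 32 + 81 / 64))
    (ha₁ : a₁ = γ + 12 * a₂ * cφ)
    (ha₃ : a₃ = 6 * (400 * Real.pi * (4 * Real.pi * (γ + 1) + 4) / m ^ 2 + 1 / 2))
    (hb₀ : b₀ = 9600 * Real.pi ^ 2 / m ^ 2)
    (hf₀ : f₀ = 3 * (16 * cφ / γ ^ 2 + 243 / 8)) :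
    M ^ 2 ≤ ME ^ 2 ∧ 0 ≤ ME ∧ (1 + (u₀ + 2 / γ) ≤ 2 * (1 + u₀)) ∧
    (τ₀ ≤ a₃ * (1 + u₀) ^ 3 * Rc ^ 2 * M ^ 2 ∧ 0 ≤ τ₀) ∧ (τ₁ ≤ a₂ * (1 + u₀) ∧ 0 ≤ τ₁) ∧
    (τ₂ ≤ γ ^ 2 * Rc / (16 * Real.pi * m) * (a₂ * (1 + u₀)) ∧ 0 ≤ τ₂) ∧
    (φ₁ ≤ 3 * Rc ^ 3 * (cφ * (1 + u₀)) ∧ 0 ≤ φ₁) ∧ (φ₀ ≤ f₀ * (1 + u₀) * Rc ^ 3 * ME ^ 2 ∧ 0 ≤ φ₀) ∧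
    (ξ₁ ≤ (1 + u₀) ^ 2 / 2 ∧ 0 ≤ ξ₁) ∧ (ξ₀ ≤ 8 * ME ^ 2 / γ ^ 2 ∧ 0 ≤ ξ₀) ∧
    (β₀ ≤ b₀ * (1 + u₀) ^ 3 * Rc * M ^ 2 ∧ 0 ≤ β₀) ∧ (β₁ ≤ 80 * Real.pi * (1 + u₀) / (m * Rc) ∧ 0 ≤ β₁) ∧
    (β₂ ≤ 5 * γ ^ 2 * (1 + u₀) / m ^ 2 ∧ 0 ≤ β₂) ∧ (e₁ ≤ 3 / Rc ^ 3 ∧ 0 ≤ e₁) ∧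
    (α₁ ≤ a₁ * (1 + u₀) ∧ 0 ≤ α₁) ∧ (α₂ ≤ 1 ∧ 0 ≤ α₂) ∧ α₂ * τ₁ ≤ 1 := by
  -- ### basic sizes (as in `twoZone_loop_reduction`)
  have hπ : 0 < Real.pi := Real.pi_pos
  have hπ3 : 3 < Real.pi := Real.pi_gt_three
  have hm0 : 0 < m := by linarith
  have hRc0 : 0 < Rc := by linarith
  have hu₀0 : 0 < u₀ := by linarith
  have hℓ : 0 < 1 / γ := by positivity
  have hℓu : 1 / γ ≤ u₀ / 64 := by
    have e : 1 / γ = (64 / γ) / 64 := by ring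
    rw [e]; linarith
  set P : ℝ := 1 + u₀ with hPdef
  have hP1 : 1 ≤ P := by rw [hPdef]; linarith
  have hP0 : 0 < P := by linarith
  have huP : u₀ ≤ P := by rw [hPdef]; linarith
  have hPpow : ∀ {j k : ℕ}, j ≤ k → P ^ j ≤ P ^ k := fun hjk => pow_le_pow_right₀ hP1 hjk
  have hRpow : ∀ {j k : ℕ}, j ≤ k → Rc ^ j ≤ Rc ^ k := fun hjk => pow_le_pow_right₀ hRc hjk
  have he3 : Real.exp 1 ≤ 3 := by
    have := Real.exp_one_lt_d9; norm_num at this; linarith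
  have he0 : 0 < Real.exp 1 := Real.exp_pos _
  have he1 : 1 ≤ Real.exp 1 := Real.one_le_exp (by norm_num)
  -- `Kb ≤ 4πP`, `c₁ ≥ m/5`
  have hKb_le : Kb ≤ 4 * Real.pi * P := by
    rw [hKb]
    have h6 : 2 / γ + 4 / γ ≤ u₀ := by
      have e : 2 / γ + 4 / γ = 6 * (1 / γ) := by ring
      rw [e]; linarith
    nlinarith only [h6, hπ, huP, hu₀0]
  have hKb0 : 0 < Kb := by rw [hKb]; positivity
  have hc₁m : m / 5 ≤ c₁ := by
    rw [hc₁]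
    have hm4 : 4 ≤ m ^ 2 := by nlinarith only [hm]
    have h45 : 16 / (5 * m ^ 2) ≤ 4 / 5 := by
      rw [div_le_iff₀ (by positivity)]; linarith only [hm4]
    have := mul_le_mul_of_nonneg_right (sub_le_sub_left h45 1) hm0.le
    linarith only [this]
  have hc₁0 : 0 < c₁ := lt_of_lt_of_le (by positivity) hc₁m
  have hinvc₁ : 1 / c₁ ≤ 5 / m := by
    rw [div_le_div_iff₀ hc₁0 hm0]; linarith only [hc₁m]
  have hinvc₁sq : 1 / c₁ ^ 2 ≤ 25 / m ^ 2 := by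
    have h1 := mul_le_mul hinvc₁ hinvc₁ (by positivity) (by positivity)
    have e1 : 1 / c₁ * (1 / c₁) = 1 / c₁ ^ 2 := by field_simp
    have e2 : 5 / m * (5 / m) = 25 / m ^ 2 := by field_simp; norm_num
    rw [e1, e2] at h1; exact h1
  -- `A₂b + 1 ≤ a₂P`
  have ha₂0 : 0 < a₂ := by rw [ha₂]; positivity
  have hA₂0 : 0 ≤ A₂b := by rw [hA₂b]; positivity
  have hA₂le : A₂b + 1 ≤ a₂ * P := by
    rw [hA₂b, ha₂]
    have h1 : 4 * ((γ + 1) * Kb + 4) / c₁ = 4 * ((γ + 1) * Kb + 4) * (1 / c₁) := by ring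
    rw [h1]
    have h2 : 4 * ((γ + 1) * Kb + 4) * (1 / c₁) ≤ 4 * ((γ + 1) * (4 * Real.pi * P) + 4 * P) * (5 / m) := by
      apply mul_le_mul _ hinvc₁ (by positivity) (by positivity)
      nlinarith only [hKb_le, hP1, hγ]
    have e : 4 * ((γ + 1) * (4 * Real.pi * P) + 4 * P) * (5 / m) + P = (20 / m * (4 * Real.pi * (γ + 1) + 4) + 1) * P := by ring
    linarith only [h2, e, hP1]
  have hA₂1 : 0 < A₂b + 1 := by linarith
  -- `12 ≤ cΦ ≤ cφ P`
  have hcφ0 : 0 < cφ := by rw [hcφ]; positivity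
  have hcΦ_le : cΦ ≤ cφ * P := by
    rw [hcΦ, hcφ]
    have h3 : u₀ + 3 / γ ≤ 2 * P := by
      have e : 3 / γ = 3 * (1 / γ) := by ring
      rw [e]; linarith
    have h4 : (1 + 36 * γ ^ 2) * (u₀ + 3 / γ) ≤ (1 + 36 * γ ^ 2) * (2 * P) := mul_le_mul_of_nonneg_left h3 (by positivity)
    have h5 : 81 * γ / 32 + 81 / 64 ≤ (81 * γ / 32 + 81 / 64) * P := by
      have := mul_le_mul_of_nonneg_left hP1 (show 0 ≤ 81 * γ / 32 + 81 / 64 by positivity)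
      linarith only [this]
    nlinarith only [h4, h5]
  have hcΦ12 : 12 ≤ cΦ := by
    rw [hcΦ]
    have h3 : u₀ ≤ u₀ + 3 / γ := by have : 0 < 3 / γ := by positivity
                                    linarith
    nlinarith only [h3, sq_nonneg γ, hu₀1, hγ]
  have hcΦ0 : 0 < cΦ := by linarith
  -- `u₀ − 1/γ ≥ P/4`, `θ′ > 0`, `1/θ′ ≤ 12a₂cφP`, `α₁ ≤ a₁P`, `α₂ ≤ 1`, `α₂τ₁ ≤ 1`
  have hx0 : P / 4 ≤ u₀ - 1 / γ := by rw [hPdef]; linarith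
  have hx0' : 0 < u₀ - 1 / γ := lt_of_lt_of_le (by positivity) hx0
  set y : ℝ := u₀ - 1 / γ with hydef
  have hθ0 : 0 < θ' := by rw [hθ']; positivity
  have hθinv : 1 / θ' ≤ 12 * a₂ * cφ * P := by
    rw [hθ', one_div_div]
    rw [div_le_iff₀ hx0']
    have h1 : Real.exp 1 * (A₂b + 1) * cΦ ≤ 3 * (a₂ * P) * (cφ * P) :=
      mul_le_mul (mul_le_mul he3 hA₂le hA₂1.le (by norm_num)) hcΦ_le hcΦ0.le (by positivity)
    have h2 : 3 * (a₂ * P) * (cφ * P) ≤ 12 * a₂ * cφ * P * (u₀ - 1 / γ) := by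
      have := mul_le_mul_of_nonneg_left hx0 (show 0 ≤ 12 * a₂ * cφ * P by positivity)
      nlinarith only [this]
    exact h1.trans h2
  have ha₁0 : 0 < a₁ := by rw [ha₁]; positivity
  have hα₁le : α₁ ≤ a₁ * P := by
    rw [hα₁, ha₁]
    have : γ ≤ γ * P := by nlinarith only [hP1, hγ]
    nlinarith only [this, hθinv, hP1]
  have hα₁0 : 0 ≤ α₁ := by rw [hα₁]; positivity
  have hα₂eq : α₂ = 1 / (4 * Real.exp 1 * (A₂b + 1) * cΦ) := by
    rw [hα₂, hθ']; field_simp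
  have hα₂0 : 0 ≤ α₂ := by rw [hα₂eq]; positivity
  have hα₂le : α₂ ≤ 1 := by
    rw [hα₂eq, div_le_one (by positivity)]
    have h1 : (1:ℝ) ≤ 4 * Real.exp 1 := by linarith
    have h2 : (1:ℝ) ≤ (A₂b + 1) * cΦ := by nlinarith only [hA₂0, hcΦ12]
    nlinarith only [h1, h2]
  have hα₂τ₁ : α₂ * τ₁ ≤ 1 := by
    rw [hα₂eq, hτ₁]
    have e : 1 / (4 * Real.exp 1 * (A₂b + 1) * cΦ) * (A₂b + 1) = 1 / (4 * Real.exp 1 * cΦ) := by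
      field_simp
    rw [e, div_le_one (by positivity)]
    nlinarith only [he1, hcΦ12]
  have hτ₁le : τ₁ ≤ a₂ * P := by rw [hτ₁]; exact hA₂le
  have hτ₁0 : 0 ≤ τ₁ := by rw [hτ₁]; positivity
  -- exponentials: `e^{γ(u₀+2/γ)/4} ≤ 3Rc³`, `e^{γ(u₀+3/γ)/4} ≤ 3Rc³`, `e₁ ≤ 3/Rc³`
  have hE2 : Real.exp (γ * (u₀ + 2 / γ) / 4) ≤ 3 * Rc ^ 3 := by
    have e : γ * (u₀ + 2 / γ) / 4 = γ * u₀ / 4 + 1 / 2 := by field_simp; ring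
    rw [e, Real.exp_add, hE, mul_comm]
    exact mul_le_mul_of_nonneg_right ((Real.exp_le_exp.mpr (by norm_num)).trans he3) (by positivity)
  have hE3 : Real.exp (γ * (u₀ + 3 / γ) / 4) ≤ 3 * Rc ^ 3 := by
    have e : γ * (u₀ + 3 / γ) / 4 = γ * u₀ / 4 + 3 / 4 := by field_simp
    rw [e, Real.exp_add, hE, mul_comm]
    exact mul_le_mul_of_nonneg_right ((Real.exp_le_exp.mpr (by norm_num)).trans he3) (by positivity)
  have he₁le : e₁ ≤ 3 / Rc ^ 3 := by
    rw [he₁, hE]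
    exact div_le_div_of_nonneg_right ((Real.exp_le_exp.mpr (by norm_num)).trans he3) (by positivity)
  have he₁0 : 0 ≤ e₁ := by rw [he₁]; positivity
  have hu2 : u₀ + 2 / γ ≤ 2 * P := by
    have e : 2 / γ = 2 * (1 / γ) := by ring
    rw [e]; linarith
  have hu20 : 0 ≤ u₀ + 2 / γ := by positivity
  have hu2' : 1 + (u₀ + 2 / γ) ≤ 2 * P := by
    have e2 : 2 / γ = 2 * (1 / γ) := by ring
    rw [hPdef, e2]; linarith [hℓu, hu₀0]
  -- `M² ≤ M_E²`
  have hME0 : 0 ≤ ME := by rw [hME]; positivity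
  have hMME : M ^ 2 ≤ ME ^ 2 := by
    have h1 : M ≤ ME := by rw [hME]; linarith [show 0 ≤ γ ^ 2 * Rc / (8 * Real.pi * m) * ((1 + u₀) ^ 2 * Real.exp (-(γ * u₀ / 4))) * N by positivity]
    exact pow_le_pow_left₀ hM h1 2
  have hME2 : 0 ≤ ME ^ 2 := by positivity
  -- ### the pieces
  have ha₃0 : 0 < a₃ := by rw [ha₃]; positivity
  have hinner : 4 * Kb * ((γ + 1) * Kb + 4) / c₁ ^ 2 + 1 / 2 ≤ (400 * Real.pi * (4 * Real.pi * (γ + 1) + 4) / m ^ 2 + 1 / 2) * P ^ 2 := by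
    have h1 : 4 * Kb * ((γ + 1) * Kb + 4) / c₁ ^ 2 = 4 * Kb * ((γ + 1) * Kb + 4) * (1 / c₁ ^ 2) := by ring
    rw [h1]
    have h2 : 4 * Kb * ((γ + 1) * Kb + 4) * (1 / c₁ ^ 2) ≤ 4 * (4 * Real.pi * P) * ((γ + 1) * (4 * Real.pi * P) + 4 * P) * (25 / m ^ 2) := by
      apply mul_le_mul _ hinvc₁sq (by positivity) (by positivity)
      exact mul_le_mul (by linarith) (by nlinarith only [hKb_le, hP1, hγ]) (by positivity) (by positivity)
    have h3 : (1:ℝ) / 2 ≤ 1 / 2 * P ^ 2 := by nlinarith only [hP1]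
    have e : 4 * (4 * Real.pi * P) * ((γ + 1) * (4 * Real.pi * P) + 4 * P) * (25 / m ^ 2) + 1 / 2 * P ^ 2
        = (400 * Real.pi * (4 * Real.pi * (γ + 1) + 4) / m ^ 2 + 1 / 2) * P ^ 2 := by ring
    linarith only [h2, h3, e]
  have hinner0 : 0 ≤ 4 * Kb * ((γ + 1) * Kb + 4) / c₁ ^ 2 + 1 / 2 := by positivity
  have hA₁le : A₁b ≤ a₃ * P ^ 3 * Rc ^ 2 := by
    rw [hA₁b]
    have h1 : (u₀ + 2 / γ) * Real.exp (γ * (u₀ + 2 / γ) / 4) / Rc = (u₀ + 2 / γ) * Real.exp (γ * (u₀ + 2 / γ) / 4) * (1 / Rc) := by ring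
    rw [h1]
    have h2 : (u₀ + 2 / γ) * Real.exp (γ * (u₀ + 2 / γ) / 4) * (1 / Rc) ≤ (2 * P) * (3 * Rc ^ 3) * (1 / Rc) :=
      mul_le_mul_three hu2 hE2 le_rfl hu20 (by positivity) (by positivity)
    have h3 := mul_le_mul h2 hinner (hinner0) (by positivity)
    have e : (2 * P) * (3 * Rc ^ 3) * (1 / Rc) * ((400 * Real.pi * (4 * Real.pi * (γ + 1) + 4) / m ^ 2 + 1 / 2) * P ^ 2)
        = a₃ * P ^ 3 * Rc ^ 2 := by rw [ha₃]; field_simp; ring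
    linarith only [h3, e]
  have hA₁0 : 0 ≤ A₁b := by rw [hA₁b]; positivity
  have hτ₀le : τ₀ ≤ a₃ * P ^ 3 * Rc ^ 2 * M ^ 2 := by rw [hτ₀]; exact mul_le_mul_of_nonneg_right hA₁le (sq_nonneg M)
  have hτ₀0 : 0 ≤ τ₀ := by rw [hτ₀]; positivity
  have hκ0 : 0 ≤ κ := by rw [hκ]; positivity
  have hτ₂le : τ₂ ≤ γ ^ 2 * Rc / (16 * Real.pi * m) * (a₂ * P) := by
    rw [hτ₂, hA₃b, hκ]
    exact mul_le_mul_of_nonneg_left (by linarith [hA₂le]) (by positivity)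
  have hτ₂0 : 0 ≤ τ₂ := by rw [hτ₂, hA₃b]; positivity
  have hφ₁le : φ₁ ≤ 3 * Rc ^ 3 * (cφ * P) := by
    rw [hφ₁]; exact mul_le_mul hE3 hcΦ_le hcΦ0.le (by positivity)
  have hφ₁0 : 0 ≤ φ₁ := by rw [hφ₁]; positivity
  have hf₀0 : 0 < f₀ := by rw [hf₀]; positivity
  have hφ₀le : φ₀ ≤ f₀ * P * Rc ^ 3 * ME ^ 2 := by
    rw [hφ₀]
    have h1 : 16 * ME ^ 2 / (γ ^ 2 * u₀ ^ 4) ≤ 16 * ME ^ 2 / γ ^ 2 := by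
      apply div_le_div_of_nonneg_left (by positivity) (by positivity)
      have : 1 ≤ u₀ ^ 4 := one_le_pow₀ hu₀1
      nlinarith only [this, sq_nonneg γ, hγ]
    have h2 : ME ^ 2 / (1 + u₀) ^ 4 ≤ ME ^ 2 := by
      apply div_le_self hME2; exact one_le_pow₀ hP1
    have h3 : cΦ * (16 * ME ^ 2 / (γ ^ 2 * u₀ ^ 4)) + 243 / 8 * (ME ^ 2 / (1 + u₀) ^ 4)
        ≤ (cφ * P) * (16 * ME ^ 2 / γ ^ 2) + 243 / 8 * ME ^ 2 := by
      have := mul_le_mul hcΦ_le h1 (by positivity) (by positivity)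
      nlinarith only [this, h2]
    have h4 := mul_le_mul hE3 h3 (by positivity) (by positivity)
    have h5 : 3 * Rc ^ 3 * ((cφ * P) * (16 * ME ^ 2 / γ ^ 2) + 243 / 8 * ME ^ 2) ≤ f₀ * P * Rc ^ 3 * ME ^ 2 := by
      rw [hf₀]
      have : 243 / 8 * ME ^ 2 ≤ 243 / 8 * ME ^ 2 * P := by nlinarith only [hP1, hME2]
      have e : 3 * (16 * cφ / γ ^ 2 + 243 / 8) * P * Rc ^ 3 * ME ^ 2
          = 3 * Rc ^ 3 * ((cφ * P) * (16 * ME ^ 2 / γ ^ 2) + 243 / 8 * ME ^ 2 * P) := by ring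
      rw [e]; nlinarith only [this, pow_nonneg hRc0.le 3]
    exact h4.trans h5
  have hφ₀0 : 0 ≤ φ₀ := by rw [hφ₀]; positivity
  have hξ₁le : ξ₁ ≤ P ^ 2 / 2 := by
    rw [hξ₁]
    have := pow_le_pow_left₀ hu₀0.le huP 2
    linarith only [this]
  have hξ₁0 : 0 ≤ ξ₁ := by rw [hξ₁]; positivity
  have hξ₀le : ξ₀ ≤ 8 * ME ^ 2 / γ ^ 2 := by
    rw [hξ₀]
    apply div_le_div_of_nonneg_left (by positivity) (by positivity)
    have : 1 ≤ u₀ ^ 2 := one_le_pow₀ hu₀1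
    nlinarith only [this, sq_nonneg γ, hγ]
  have hξ₀0 : 0 ≤ ξ₀ := by rw [hξ₀]; positivity
  have hb₀0 : 0 < b₀ := by rw [hb₀]; positivity
  have hβ₀le : β₀ ≤ b₀ * P ^ 3 * Rc * M ^ 2 := by
    rw [hβ₀]
    have h1 : Kb * (4 * Kb * (M ^ 2 * ((u₀ + 2 / γ) * Real.exp (γ * (u₀ + 2 / γ) / 4))) / (c₁ ^ 2 * Rc ^ 2))
        = Kb * Kb * ((u₀ + 2 / γ) * Real.exp (γ * (u₀ + 2 / γ) / 4)) * (1 / c₁ ^ 2) * (4 * M ^ 2 / Rc ^ 2) := by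
      field_simp
    rw [h1]
    have h2 : (u₀ + 2 / γ) * Real.exp (γ * (u₀ + 2 / γ) / 4) ≤ (2 * P) * (3 * Rc ^ 3) :=
      mul_le_mul hu2 hE2 (by positivity) (by positivity)
    have h3 : Kb * Kb * ((u₀ + 2 / γ) * Real.exp (γ * (u₀ + 2 / γ) / 4)) * (1 / c₁ ^ 2)
        ≤ (4 * Real.pi * P) * (4 * Real.pi * P) * ((2 * P) * (3 * Rc ^ 3)) * (25 / m ^ 2) :=
      mul_le_mul_four hKb_le hKb_le h2 hinvc₁sq hKb0.le hKb0.le (by positivity) (by positivity)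
    have h4 := mul_le_mul_of_nonneg_right h3 (show 0 ≤ 4 * M ^ 2 / Rc ^ 2 by positivity)
    have e : (4 * Real.pi * P) * (4 * Real.pi * P) * ((2 * P) * (3 * Rc ^ 3)) * (25 / m ^ 2) * (4 * M ^ 2 / Rc ^ 2)
        = b₀ * P ^ 3 * Rc * M ^ 2 := by rw [hb₀]; field_simp; ring
    linarith only [h4, e]
  have hβ₀0 : 0 ≤ β₀ := by rw [hβ₀]; positivity
  have hβ₁le : β₁ ≤ 80 * Real.pi * P / (m * Rc) := by
    rw [hβ₁]
    have h1 : 4 / (c₁ * Rc) = 4 * (1 / c₁) * (1 / Rc) := by field_simp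
    rw [h1]
    have h2 : Kb * (4 * (1 / c₁) * (1 / Rc)) ≤ 4 * Real.pi * P * (4 * (5 / m) * (1 / Rc)) :=
      mul_le_mul hKb_le (by
        apply mul_le_mul_of_nonneg_right _ (by positivity)
        linarith only [hinvc₁]) (by positivity) (by positivity)
    have e : 4 * Real.pi * P * (4 * (5 / m) * (1 / Rc)) = 80 * Real.pi * P / (m * Rc) := by field_simp; norm_num
    linarith only [h2, e]
  have hβ₁0 : 0 ≤ β₁ := by rw [hβ₁]; positivity
  have hβ₂le : β₂ ≤ 5 * γ ^ 2 * P / m ^ 2 := by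
    rw [hβ₂, hκ]
    have h1 : 4 * (γ ^ 2 * Rc / (16 * Real.pi * m)) / (c₁ * Rc) = γ ^ 2 / (4 * Real.pi * m) * (1 / c₁) := by
      field_simp; ring
    rw [h1]
    have h2 : Kb * (γ ^ 2 / (4 * Real.pi * m) * (1 / c₁)) ≤ 4 * Real.pi * P * (γ ^ 2 / (4 * Real.pi * m) * (5 / m)) :=
      mul_le_mul hKb_le (mul_le_mul_of_nonneg_left hinvc₁ (by positivity)) (by positivity) (by positivity)
    have e : 4 * Real.pi * P * (γ ^ 2 / (4 * Real.pi * m) * (5 / m)) = 5 * γ ^ 2 * P / m ^ 2 := by field_simp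
    linarith only [h2, e]
  have hβ₂0 : 0 ≤ β₂ := by rw [hβ₂, hκ]; positivity
  exact ⟨hMME, hME0, hu2', ⟨hτ₀le, hτ₀0⟩, ⟨hτ₁le, hτ₁0⟩, ⟨hτ₂le, hτ₂0⟩, ⟨hφ₁le, hφ₁0⟩, ⟨hφ₀le, hφ₀0⟩, ⟨hξ₁le, hξ₁0⟩, ⟨hξ₀le, hξ₀0⟩,
    ⟨hβ₀le, hβ₀0⟩, ⟨hβ₁le, hβ₁0⟩, ⟨hβ₂le, hβ₂0⟩, ⟨he₁le, he₁0⟩, ⟨hα₁le, hα₁0⟩, ⟨hα₂le, hα₂0⟩, hα₂τ₁⟩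

end Summit.NavierStokesRegularity.NavierStokesRegularity.Theorems.DefectColumnGate

end
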